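import Mathlib
import Summits.NavierStokesRegularity.NavierStokesRegularity.Theorems.EulerZoomLiouvillePowerGaugeEulerLiouvilleWeakSupportDensityBootstrap
import HarnessLib

/-!
# Crux `EulerZoomLiouville.PowerGaugeEulerLiouville` (stmt-NavierStokesRegularity-19832): THE SUPPORT DENSITY EXISTS (set form)
# — the `q = 0` anchor of ROUND-53 «THE FLOOR» (nsreg-p2 g43, `r53/Sketch53.lean` (F3a) `SupportDensityFloor`)

Route №10 `EulerZoomLiouville` (NavierStokesRegularity), crux E = stmt-NavierStokesRegularity-19832; LEAD ns-typeII-p2 g15, on ns-ezl-w1 g8's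
dilation calculus (`…WeakSupportDensityDilation`, `…WeakSupportDensityBootstrap`) BY NAME.  Pure real analysis on `ℝ³`, no fluid object.

Setting (as in the bootstrap file): `γ, ρ > 0`; `V ∈ L¹_loc ∩ L²_loc(ℝ³)` with the `A`-gauge growth `∫_{B_L}‖V‖² ≤ C_A L^{1−2ρ}` (`L ≥ 2`); a set `S`
obeying the SUPPORT LAW `∫_S (3γψ + Dψ[W]) = 0` (`W = γy + V`) for every test `ψ`; a bump `f` with `rIn = 1`, normalised mass `q_f(R) = R⁻³∫_S f(R⁻¹y)`
and error functional `E(s) = ∫_S Df(s⁻¹y)[V y]`.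

* `exists_abs_errE_le_rpow` — `|E(s)| ≤ K·s^{2−ρ}` for `s ≥ 1` (Cauchy–Schwarz `abs_errE_le` with the trivial volume bound `vol(S ∩ B_t) ≤ |B₁|t³`);
* `integrableOn_errE_div_Ioi` — the tail `E(s)/(γs⁵)` is integrable on `(r, ∞)`, `r ≥ 1`, with `∫_r^∞ |E|/(γs⁵) ≤ (K/γ)·r^{−(2+ρ)}/(2+ρ)`;
* `massF_div_cube_eq` — `q_f(R) = q_f(1) + ∫_1^R E/(γs⁵)` (`massF_div_cube_sub`);
* `tendsto_massF_div_cube_lim` — **`q_f(R) → L_f := q_f(1) + ∫_1^∞ E/(γs⁵)`** (`intervalIntegral_tendsto_integral_Ioi`), with the RATE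
  `abs_massF_div_cube_sub_lim_le`: `|q_f(R) − L_f| ≤ (K/γ)·R^{−(2+ρ)}/(2+ρ)` (`R ≥ 1`), and `0 ≤ L_f ≤ |B₁|·rOut³` (`lim_nonneg`, `lim_le`);
* `sharpDensity_le_massF_div_cube` / `massF_div_cube_le_sharpDensity` — the sandwich `vol(S ∩ B_R)/R³ ≤ q_f(R)`, `q_f(R/rOut) ≤ rOut³ · vol(S ∩ B_R)/R³`;
* `exists_tendsto_sharpDensity` — **THE SHARP DENSITY CONVERGES**: `vol(S ∩ B_R)/R³ → d` for some `d ≥ 0` (Cauchy, bumps `⟨1, 1+δ⟩`, `δ ↓ 0`);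
* `measure_eq_zero_of_tendsto_sharpDensity_zero` — `d = 0 ⇒ vol S = 0` (ns-ezl-w1 g8's `measure_eq_zero_of_supportLaw_of_density`).

So a set obeying the support law in the budget class has an ASYMPTOTIC DENSITY, and it is null unless that density is positive — the liminf form of
the support-density law.  The profile-level corollary (F3a) and the needle digest form are in `…NeedleSupportDensityFloor`.
[folklore; DiPernaLions1989 §II (renormalised support laws); the `q = 0` case of ChaeShvydkoy2013 §4 eq. (4.2)]

WHAT THIS IS NOT: not NS, not E, not a member — an instrument (two-sided portrait of a HYPOTHETICAL survivor's vortical support); 19832 OPEN.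
-/

noncomputable section

-- flat `Theorems/<Route><Decl>…` files of one crux share the namespace of the crux (tree convention)
set_option linter.dupNamespace false

open MeasureTheory Set Filter Topology Metric Function TopologicalSpace
open scoped ENNReal NNReal ContDiff

namespace Summit.NavierStokesRegularity.NavierStokesRegularity.Theorems.PowerGaugeEulerLiouville.WeakEulerian

open Literature.Analysis Literature.Analysis.FunctionSpaces Literature.Analysis.FluidPDE

variable (f : ContDiffBump (0 : EuclideanSpace ℝ (Fin 3)))
variable {S : Set (EuclideanSpace ℝ (Fin 3))} {V : EuclideanSpace ℝ (Fin 3) → EuclideanSpace ℝ (Fin 3)} {γ ρ CA : ℝ}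

/-! ### The error functional decays like `s^{2−ρ}` -/

/-- **`|E(s)| ≤ K·s^{2−ρ}` for `s ≥ 1`** (`rIn = 1`, so `rOut > 1` and `2·rOut·s ≥ 2`): `abs_errE_le` with `vol(S ∩ B_t) ≤ |B₁|t³` and the
`A`-growth `∫_{B_t}‖V‖² ≤ C_A t^{1−2ρ}` at `t = 2·rOut·s`. -/
theorem exists_abs_errE_le_rpow (hV2 : ∀ r : ℝ, MemLp V 2 (volume.restrict (ball (0 : EuclideanSpace ℝ (Fin 3)) r)))
    (hCA : 0 ≤ CA) (hA : ∀ L : ℝ, 2 ≤ L → ∫ y in ball (0 : EuclideanSpace ℝ (Fin 3)) L, ‖V y‖ ^ 2 ≤ CA * L ^ (1 - 2 * ρ))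
    (hIn : f.rIn = 1) :
    ∃ K : ℝ, 0 ≤ K ∧ ∀ s : ℝ, 1 ≤ s → |∫ y in S, fderiv ℝ f (s⁻¹ • y) (V y)| ≤ K * s ^ (2 - ρ) := by
  obtain ⟨M, hM0, hM⟩ := exists_bound_fderiv_bump f
  have hO1 : 1 < f.rOut := hIn ▸ f.rIn_lt_rOut
  have hO : 0 < f.rOut := f.rOut_pos
  set C₀ : ℝ := Real.pi * 4 / 3 with hC₀
  have hC₀0 : 0 ≤ C₀ := by positivity
  refine ⟨M * (C₀ ^ (1 / 2 : ℝ) * CA ^ (1 / 2 : ℝ)) * (2 * f.rOut) ^ (2 - ρ), by positivity, fun s hs => ?_⟩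
  have hs0 : 0 < s := by linarith
  have hL : 2 ≤ 2 * f.rOut * s := by nlinarith
  have hpos : 0 < 2 * f.rOut * s := by positivity
  have h1 := abs_errE_le f (S := S) hV2 hM0 hM hs0
  have hvol : (volume (S ∩ ball (0 : EuclideanSpace ℝ (Fin 3)) (2 * f.rOut * s))).toReal ≤ C₀ * (2 * f.rOut * s) ^ (3 : ℝ) := by
    calc (volume (S ∩ ball (0 : EuclideanSpace ℝ (Fin 3)) (2 * f.rOut * s))).toReal
        ≤ (volume (ball (0 : EuclideanSpace ℝ (Fin 3)) (2 * f.rOut * s))).toReal :=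
          ENNReal.toReal_mono measure_ball_lt_top.ne (measure_mono inter_subset_right)
      _ = C₀ * (2 * f.rOut * s) ^ (3 : ℝ) := by rw [volume_ball_toReal hpos.le, Real.rpow_ofNat, hC₀]; ring
  have h2 : (volume (S ∩ ball (0 : EuclideanSpace ℝ (Fin 3)) (2 * f.rOut * s))).toReal ^ (1 / 2 : ℝ) ≤
      (C₀ * (2 * f.rOut * s) ^ (3 : ℝ)) ^ (1 / 2 : ℝ) :=
    Real.rpow_le_rpow ENNReal.toReal_nonneg hvol (by norm_num)
  have h3 : (∫ y in ball (0 : EuclideanSpace ℝ (Fin 3)) (2 * f.rOut * s), ‖V y‖ ^ 2) ^ (1 / 2 : ℝ) ≤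
      (CA * (2 * f.rOut * s) ^ (1 - 2 * ρ)) ^ (1 / 2 : ℝ) :=
    Real.rpow_le_rpow (integral_nonneg fun y => by positivity) (hA _ hL) (by norm_num)
  have e1 : (C₀ * (2 * f.rOut * s) ^ (3 : ℝ)) ^ (1 / 2 : ℝ) = C₀ ^ (1 / 2 : ℝ) * (2 * f.rOut * s) ^ ((3 : ℝ) * (1 / 2)) := by
    rw [Real.mul_rpow hC₀0 (by positivity), ← Real.rpow_mul hpos.le]
  have e2 : (CA * (2 * f.rOut * s) ^ (1 - 2 * ρ)) ^ (1 / 2 : ℝ) = CA ^ (1 / 2 : ℝ) * (2 * f.rOut * s) ^ ((1 - 2 * ρ) * (1 / 2)) := by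
    rw [Real.mul_rpow hCA (by positivity), ← Real.rpow_mul hpos.le]
  have e3 : (2 * f.rOut * s) ^ ((3 : ℝ) * (1 / 2)) * (2 * f.rOut * s) ^ ((1 - 2 * ρ) * (1 / 2)) =
      (2 * f.rOut) ^ (2 - ρ) * s ^ (2 - ρ) := by
    rw [← Real.rpow_add hpos, ← Real.mul_rpow (by positivity) hs0.le]
    congr 1
    ring
  calc |∫ y in S, fderiv ℝ f (s⁻¹ • y) (V y)|
      ≤ M * (volume (S ∩ ball (0 : EuclideanSpace ℝ (Fin 3)) (2 * f.rOut * s))).toReal ^ (1 / 2 : ℝ) *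
          (∫ y in ball (0 : EuclideanSpace ℝ (Fin 3)) (2 * f.rOut * s), ‖V y‖ ^ 2) ^ (1 / 2 : ℝ) := h1
    _ ≤ M * (C₀ * (2 * f.rOut * s) ^ (3 : ℝ)) ^ (1 / 2 : ℝ) * (CA * (2 * f.rOut * s) ^ (1 - 2 * ρ)) ^ (1 / 2 : ℝ) :=
        mul_le_mul (mul_le_mul_of_nonneg_left h2 hM0) h3 (by positivity) (by positivity)
    _ = M * (C₀ ^ (1 / 2 : ℝ) * CA ^ (1 / 2 : ℝ)) *
          ((2 * f.rOut * s) ^ ((3 : ℝ) * (1 / 2)) * (2 * f.rOut * s) ^ ((1 - 2 * ρ) * (1 / 2))) := by rw [e1, e2]; ring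
    _ = M * (C₀ ^ (1 / 2 : ℝ) * CA ^ (1 / 2 : ℝ)) * (2 * f.rOut) ^ (2 - ρ) * s ^ (2 - ρ) := by rw [e3]; ring

/-! ### The tail of the exact law is integrable -/

/-- **The tail `E(s)/(γs⁵)` is integrable on `(r, ∞)` (`r ≥ 1`) and `∫_r^∞ |E|/(γs⁵) ≤ (K/γ)·r^{−(2+ρ)}/(2+ρ)`**, given `|E(s)| ≤ K s^{2−ρ}`
(`s ≥ 1`), `γ > 0`, `ρ > 0` (any `ρ > −2` would do). -/
theorem integrableOn_errE_div_Ioi (hγ : 0 < γ) (hρ : 0 < ρ) (hV : LocallyIntegrable V volume)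
    {K : ℝ} (hK : ∀ s : ℝ, 1 ≤ s → |∫ y in S, fderiv ℝ f (s⁻¹ • y) (V y)| ≤ K * s ^ (2 - ρ))
    {r : ℝ} (hr : 1 ≤ r) :
    IntegrableOn (fun s : ℝ => (∫ y in S, fderiv ℝ f (s⁻¹ • y) (V y)) / (γ * s ^ 5)) (Ioi r) volume ∧
      ∫ s in Ioi r, |(∫ y in S, fderiv ℝ f (s⁻¹ • y) (V y)) / (γ * s ^ 5)| ≤ K / γ * (r ^ (-(2 + ρ)) / (2 + ρ)) := by
  have hr0 : 0 < r := by linarith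
  have ha5 : 2 - ρ - 5 < -1 := by linarith
  have hdom_int : IntegrableOn (fun s : ℝ => K / γ * s ^ (2 - ρ - 5)) (Ioi r) volume :=
    (integrableOn_Ioi_rpow_of_lt ha5 hr0).const_mul _
  have hmeas : AEStronglyMeasurable (fun s : ℝ => (∫ y in S, fderiv ℝ f (s⁻¹ • y) (V y)) / (γ * s ^ 5))
      (volume.restrict (Ioi r)) := by
    refine ContinuousOn.aestronglyMeasurable (fun s hs => ?_) measurableSet_Ioi
    have hs0 : 0 < s := lt_trans hr0 hs
    exact ((continuousAt_errE f (S := S) hs0 hV).div ((continuousAt_const.mul (continuousAt_pow s 5)))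
      (mul_ne_zero hγ.ne' (pow_ne_zero 5 hs0.ne'))).continuousWithinAt
  have hle : ∀ s ∈ Ioi r, ‖(∫ y in S, fderiv ℝ f (s⁻¹ • y) (V y)) / (γ * s ^ 5)‖ ≤ K / γ * s ^ (2 - ρ - 5) := by
    intro s hs
    have hs0 : 0 < s := lt_trans hr0 hs
    rw [Real.norm_eq_abs, abs_div, abs_of_pos (by positivity : 0 < γ * s ^ 5), div_le_iff₀ (by positivity)]
    calc |∫ y in S, fderiv ℝ f (s⁻¹ • y) (V y)| ≤ K * s ^ (2 - ρ) := hK s (le_trans hr hs.le)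
      _ = K / γ * s ^ (2 - ρ - 5) * (γ * s ^ 5) := by
          rw [Real.rpow_sub hs0 (2 - ρ) (5 : ℝ), Real.rpow_ofNat]
          field_simp
  have hint : IntegrableOn (fun s : ℝ => (∫ y in S, fderiv ℝ f (s⁻¹ • y) (V y)) / (γ * s ^ 5)) (Ioi r) volume :=
    Integrable.mono' hdom_int hmeas (eventually_of_mem (self_mem_ae_restrict measurableSet_Ioi) hle)
  refine ⟨hint, ?_⟩
  calc ∫ s in Ioi r, |(∫ y in S, fderiv ℝ f (s⁻¹ • y) (V y)) / (γ * s ^ 5)|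
      ≤ ∫ s in Ioi r, K / γ * s ^ (2 - ρ - 5) :=
        setIntegral_mono_on hint.abs hdom_int measurableSet_Ioi fun s hs => by rw [← Real.norm_eq_abs]; exact hle s hs
    _ = K / γ * (r ^ (-(2 + ρ)) / (2 + ρ)) := by
        rw [integral_const_mul, integral_Ioi_rpow_of_lt ha5 hr0, show 2 - ρ - 5 + 1 = -(2 + ρ) by ring, neg_div_neg_eq]

/-! ### The normalised bump mass converges, with rate -/

/-- **`q_f(R) = q_f(1) + ∫_1^R E(s)/(γs⁵) ds`** for `R ≥ 1` (`massF_div_cube_sub` between `1` and `R`). -/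
theorem massF_div_cube_eq (hγ : 0 < γ) (hV : LocallyIntegrable V volume)
    (hlaw : ∀ ψ : EuclideanSpace ℝ (Fin 3) → ℝ, IsTestFunctionOn (⊤ : Opens (EuclideanSpace ℝ (Fin 3))) ψ →
      ∫ y in S, (3 * γ * ψ y + fderiv ℝ ψ y (selfSimilarTransport γ 0 V y)) = 0)
    {R : ℝ} (hR : 1 ≤ R) :
    (∫ y in S, f (R⁻¹ • y)) / R ^ 3 =
      (∫ y in S, f y) + ∫ s in (1 : ℝ)..R, (∫ y in S, fderiv ℝ f (s⁻¹ • y) (V y)) / (γ * s ^ 5) := by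
  have h := massF_div_cube_sub f hγ.ne' hV hlaw one_pos hR
  have e : (∫ y in S, f ((1 : ℝ)⁻¹ • y)) / (1 : ℝ) ^ 3 = ∫ y in S, f y := by
    simp only [inv_one, one_smul, one_pow, div_one]
  linarith

/-- **THE NORMALISED BUMP MASS CONVERGES: `q_f(R) → L_f := q_f(1) + ∫_1^∞ E/(γs⁵)`** as `R → ∞`. -/
theorem tendsto_massF_div_cube_lim (hγ : 0 < γ) (hρ : 0 < ρ) (hV : LocallyIntegrable V volume)
    (hlaw : ∀ ψ : EuclideanSpace ℝ (Fin 3) → ℝ, IsTestFunctionOn (⊤ : Opens (EuclideanSpace ℝ (Fin 3))) ψ →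
      ∫ y in S, (3 * γ * ψ y + fderiv ℝ ψ y (selfSimilarTransport γ 0 V y)) = 0)
    {K : ℝ} (hK : ∀ s : ℝ, 1 ≤ s → |∫ y in S, fderiv ℝ f (s⁻¹ • y) (V y)| ≤ K * s ^ (2 - ρ)) :
    Tendsto (fun R : ℝ => (∫ y in S, f (R⁻¹ • y)) / R ^ 3) atTop
      (𝓝 ((∫ y in S, f y) + ∫ s in Ioi (1 : ℝ), (∫ y in S, fderiv ℝ f (s⁻¹ • y) (V y)) / (γ * s ^ 5))) := by
  have hint := (integrableOn_errE_div_Ioi f hγ hρ hV hK le_rfl).1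
  have h1 : Tendsto (fun R : ℝ => ∫ s in (1 : ℝ)..R, (∫ y in S, fderiv ℝ f (s⁻¹ • y) (V y)) / (γ * s ^ 5)) atTop
      (𝓝 (∫ s in Ioi (1 : ℝ), (∫ y in S, fderiv ℝ f (s⁻¹ • y) (V y)) / (γ * s ^ 5))) :=
    intervalIntegral_tendsto_integral_Ioi 1 hint tendsto_id
  refine ((tendsto_const_nhds (x := ∫ y in S, f y)).add h1).congr' ?_
  filter_upwards [eventually_ge_atTop (1 : ℝ)] with R hR
  exact (massF_div_cube_eq f hγ hV hlaw hR).symm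

/-- **THE RATE: `|q_f(R) − L_f| ≤ (K/γ)·R^{−(2+ρ)}/(2+ρ)`** for `R ≥ 1` (`q_f(R) − L_f = −∫_R^∞ E/(γs⁵)`). -/
theorem abs_massF_div_cube_sub_lim_le (hγ : 0 < γ) (hρ : 0 < ρ) (hV : LocallyIntegrable V volume)
    (hlaw : ∀ ψ : EuclideanSpace ℝ (Fin 3) → ℝ, IsTestFunctionOn (⊤ : Opens (EuclideanSpace ℝ (Fin 3))) ψ →
      ∫ y in S, (3 * γ * ψ y + fderiv ℝ ψ y (selfSimilarTransport γ 0 V y)) = 0)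
    {K : ℝ} (hK : ∀ s : ℝ, 1 ≤ s → |∫ y in S, fderiv ℝ f (s⁻¹ • y) (V y)| ≤ K * s ^ (2 - ρ)) {R : ℝ} (hR : 1 ≤ R) :
    |(∫ y in S, f (R⁻¹ • y)) / R ^ 3 -
        ((∫ y in S, f y) + ∫ s in Ioi (1 : ℝ), (∫ y in S, fderiv ℝ f (s⁻¹ • y) (V y)) / (γ * s ^ 5))| ≤
      K / γ * (R ^ (-(2 + ρ)) / (2 + ρ)) := by
  obtain ⟨hint1, -⟩ := integrableOn_errE_div_Ioi f hγ hρ hV hK le_rfl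
  obtain ⟨hintR, htailR⟩ := integrableOn_errE_div_Ioi f hγ hρ hV hK hR
  rw [massF_div_cube_eq f hγ hV hlaw hR, ← intervalIntegral.integral_interval_add_Ioi hint1 hintR]
  have e : (∫ y in S, f y) + (∫ s in (1 : ℝ)..R, (∫ y in S, fderiv ℝ f (s⁻¹ • y) (V y)) / (γ * s ^ 5)) -
      ((∫ y in S, f y) + ((∫ s in (1 : ℝ)..R, (∫ y in S, fderiv ℝ f (s⁻¹ • y) (V y)) / (γ * s ^ 5)) +
        ∫ s in Ioi R, (∫ y in S, fderiv ℝ f (s⁻¹ • y) (V y)) / (γ * s ^ 5))) =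
      -∫ s in Ioi R, (∫ y in S, fderiv ℝ f (s⁻¹ • y) (V y)) / (γ * s ^ 5) := by ring
  rw [e, abs_neg]
  exact (abs_integral_le_integral_abs).trans htailR

/-- `0 ≤ L_f`: the limit of the non-negative `q_f`. -/
theorem lim_nonneg (hγ : 0 < γ) (hρ : 0 < ρ) (hV : LocallyIntegrable V volume)
    (hlaw : ∀ ψ : EuclideanSpace ℝ (Fin 3) → ℝ, IsTestFunctionOn (⊤ : Opens (EuclideanSpace ℝ (Fin 3))) ψ →
      ∫ y in S, (3 * γ * ψ y + fderiv ℝ ψ y (selfSimilarTransport γ 0 V y)) = 0)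
    {K : ℝ} (hK : ∀ s : ℝ, 1 ≤ s → |∫ y in S, fderiv ℝ f (s⁻¹ • y) (V y)| ≤ K * s ^ (2 - ρ)) :
    0 ≤ (∫ y in S, f y) + ∫ s in Ioi (1 : ℝ), (∫ y in S, fderiv ℝ f (s⁻¹ • y) (V y)) / (γ * s ^ 5) := by
  refine ge_of_tendsto (tendsto_massF_div_cube_lim f hγ hρ hV hlaw hK) ?_
  filter_upwards [eventually_gt_atTop (0 : ℝ)] with R hR
  exact div_nonneg (massF_nonneg f R) (pow_pos hR 3).le

/-- `L_f ≤ |B₁|·rOut³`: `q_f(R) ≤ vol(S ∩ B_{rOut R})/R³ ≤ |B₁| rOut³`. -/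
theorem lim_le (hγ : 0 < γ) (hρ : 0 < ρ) (hV : LocallyIntegrable V volume)
    (hlaw : ∀ ψ : EuclideanSpace ℝ (Fin 3) → ℝ, IsTestFunctionOn (⊤ : Opens (EuclideanSpace ℝ (Fin 3))) ψ →
      ∫ y in S, (3 * γ * ψ y + fderiv ℝ ψ y (selfSimilarTransport γ 0 V y)) = 0)
    {K : ℝ} (hK : ∀ s : ℝ, 1 ≤ s → |∫ y in S, fderiv ℝ f (s⁻¹ • y) (V y)| ≤ K * s ^ (2 - ρ)) :
    (∫ y in S, f y) + ∫ s in Ioi (1 : ℝ), (∫ y in S, fderiv ℝ f (s⁻¹ • y) (V y)) / (γ * s ^ 5) ≤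
      Real.pi * 4 / 3 * f.rOut ^ 3 := by
  have hO : 0 < f.rOut := f.rOut_pos
  refine le_of_tendsto (tendsto_massF_div_cube_lim f hγ hρ hV hlaw hK) ?_
  filter_upwards [eventually_gt_atTop (0 : ℝ)] with R hR
  rw [div_le_iff₀ (pow_pos hR 3)]
  calc ∫ y in S, f (R⁻¹ • y) ≤ (volume (S ∩ ball (0 : EuclideanSpace ℝ (Fin 3)) (f.rOut * R))).toReal :=
        massF_le_measure_inter_ball f hR
    _ ≤ (volume (ball (0 : EuclideanSpace ℝ (Fin 3)) (f.rOut * R))).toReal :=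
        ENNReal.toReal_mono measure_ball_lt_top.ne (measure_mono inter_subset_right)
    _ = Real.pi * 4 / 3 * f.rOut ^ 3 * R ^ 3 := by rw [volume_ball_toReal (by positivity)]; ring

/-! ### The sandwich between the sharp density and the bump masses -/

/-- `vol(S ∩ B_R)/R³ ≤ q_f(R)` (`rIn = 1`, `R > 0`). -/
theorem sharpDensity_le_massF_div_cube (hIn : f.rIn = 1) {R : ℝ} (hR : 0 < R) :
    (volume (S ∩ ball (0 : EuclideanSpace ℝ (Fin 3)) R)).toReal / R ^ 3 ≤ (∫ y in S, f (R⁻¹ • y)) / R ^ 3 := by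
  have hmass := measure_inter_closedBall_le_massF f (S := S) hR
  rw [hIn, one_mul] at hmass
  have hball : (volume (S ∩ ball (0 : EuclideanSpace ℝ (Fin 3)) R)).toReal ≤
      (volume (S ∩ closedBall (0 : EuclideanSpace ℝ (Fin 3)) R)).toReal :=
    ENNReal.toReal_mono (lt_of_le_of_lt (measure_mono inter_subset_right) measure_closedBall_lt_top).ne
      (measure_mono (inter_subset_inter_right _ ball_subset_closedBall))
  exact div_le_div_of_nonneg_right (hball.trans hmass) (pow_pos hR 3).le

/-- `q_f(R/rOut) ≤ rOut³ · vol(S ∩ B_R)/R³` (`R > 0`). -/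
theorem massF_div_cube_le_sharpDensity {R : ℝ} (hR : 0 < R) :
    (∫ y in S, f ((R / f.rOut)⁻¹ • y)) / (R / f.rOut) ^ 3 ≤
      f.rOut ^ 3 * ((volume (S ∩ ball (0 : EuclideanSpace ℝ (Fin 3)) R)).toReal / R ^ 3) := by
  have hO : 0 < f.rOut := f.rOut_pos
  have hr : 0 < R / f.rOut := div_pos hR hO
  have h := massF_le_measure_inter_ball f (S := S) hr
  have e : f.rOut * (R / f.rOut) = R := by field_simp
  rw [e] at h
  calc (∫ y in S, f ((R / f.rOut)⁻¹ • y)) / (R / f.rOut) ^ 3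
      ≤ (volume (S ∩ ball (0 : EuclideanSpace ℝ (Fin 3)) R)).toReal / (R / f.rOut) ^ 3 :=
        div_le_div_of_nonneg_right h (pow_pos hr 3).le
    _ = f.rOut ^ 3 * ((volume (S ∩ ball (0 : EuclideanSpace ℝ (Fin 3)) R)).toReal / R ^ 3) := by
        rw [div_pow]
        field_simp

/-! ### The sharp density converges -/

omit f in
/-- **THE SHARP DENSITY CONVERGES.**  `γ, ρ > 0`, `V ∈ L¹_loc ∩ L²_loc` with the `A`-growth, `S` obeying the support law ⇒
`vol(S ∩ B_R)/R³ → d` for some `d ≥ 0`.  Proof: for the bump `⟨1, 1+δ⟩` the sandwich gives, for large `m, n`,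
`D(m) ≤ L_δ + ε′` and `(1+δ)³·D(n) ≥ L_δ − ε′`, and `L_δ((1+δ)³ − 1) ≤ 56|B₁|δ`; so `D` is Cauchy at `∞`. -/
theorem exists_tendsto_sharpDensity (hγ : 0 < γ) (hρ : 0 < ρ) (hV : LocallyIntegrable V volume)
    (hV2 : ∀ r : ℝ, MemLp V 2 (volume.restrict (ball (0 : EuclideanSpace ℝ (Fin 3)) r)))
    (hCA : 0 ≤ CA) (hA : ∀ L : ℝ, 2 ≤ L → ∫ y in ball (0 : EuclideanSpace ℝ (Fin 3)) L, ‖V y‖ ^ 2 ≤ CA * L ^ (1 - 2 * ρ))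
    (hlaw : ∀ ψ : EuclideanSpace ℝ (Fin 3) → ℝ, IsTestFunctionOn (⊤ : Opens (EuclideanSpace ℝ (Fin 3))) ψ →
      ∫ y in S, (3 * γ * ψ y + fderiv ℝ ψ y (selfSimilarTransport γ 0 V y)) = 0) :
    ∃ d : ℝ, 0 ≤ d ∧
      Tendsto (fun R : ℝ => (volume (S ∩ ball (0 : EuclideanSpace ℝ (Fin 3)) R)).toReal / R ^ 3) atTop (𝓝 d) := by
  set D : ℝ → ℝ := fun R => (volume (S ∩ ball (0 : EuclideanSpace ℝ (Fin 3)) R)).toReal / R ^ 3 with hD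
  set C₀ : ℝ := Real.pi * 4 / 3 with hC₀
  have hC₀0 : 0 < C₀ := by positivity
  -- ### the Cauchy property
  have hCauchy : CauchySeq D := by
    refine Metric.cauchySeq_iff.2 fun ε hε => ?_
    -- the bump `⟨1, 1 + δ⟩`
    set δ : ℝ := min 1 (ε / (224 * C₀ + 1)) with hδ
    have hδ0 : 0 < δ := lt_min one_pos (by positivity)
    have hδ1 : δ ≤ 1 := min_le_left _ _
    have hδε : 56 * C₀ * δ ≤ ε / 4 := by
      have h1 : δ ≤ ε / (224 * C₀ + 1) := min_le_right _ _
      have h2 : 56 * C₀ * (ε / (224 * C₀ + 1)) ≤ ε / 4 := by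
        rw [div_eq_mul_inv, div_eq_mul_inv]
        have h3 : 56 * C₀ * (224 * C₀ + 1)⁻¹ ≤ 4⁻¹ := by
          rw [← div_eq_mul_inv, div_le_iff₀ (by positivity)]
          nlinarith
        nlinarith
      nlinarith
    set g : ContDiffBump (0 : EuclideanSpace ℝ (Fin 3)) := ⟨1, 1 + δ, one_pos, by linarith⟩ with hg
    have hgIn : g.rIn = 1 := rfl
    have hgOut : g.rOut = 1 + δ := rfl
    set P : ℝ := (1 + δ) ^ 3 with hP
    have hP1 : 1 ≤ P := one_le_pow₀ (by linarith)
    have hP8 : P ≤ 8 := by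
      have : (1 + δ) ^ 3 ≤ (2 : ℝ) ^ 3 := by gcongr; linarith
      rw [hP]; linarith
    have hPδ : P - 1 ≤ 7 * δ := by
      have h2 : δ ^ 2 ≤ δ := by nlinarith
      have h3 : δ ^ 3 ≤ δ := by nlinarith
      rw [hP]; nlinarith
    obtain ⟨K, hK0, hK⟩ := exists_abs_errE_le_rpow g (S := S) hV2 hCA hA hgIn
    set L : ℝ := (∫ y in S, g y) + ∫ s in Ioi (1 : ℝ), (∫ y in S, fderiv ℝ g (s⁻¹ • y) (V y)) / (γ * s ^ 5) with hL
    have hlim := tendsto_massF_div_cube_lim g hγ hρ hV hlaw hK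
    have hL0 : 0 ≤ L := lim_nonneg g hγ hρ hV hlaw hK
    have hLle : L ≤ C₀ * P := by
      have := lim_le g hγ hρ hV hlaw hK
      rw [hgOut] at this
      simpa only [hC₀, hP] using this
    -- tails `< ε/8` beyond `R₁ ≥ 1`
    have hev : ∀ᶠ R in atTop, |(∫ y in S, g (R⁻¹ • y)) / R ^ 3 - L| < ε / 8 :=
      (Metric.tendsto_nhds.1 hlim) (ε / 8) (by positivity)
    obtain ⟨R₁, hR₁⟩ := (hev.and (eventually_ge_atTop (1 : ℝ))).exists_forall_of_atTop
    refine ⟨(1 + δ) * R₁, fun m hm n hn => ?_⟩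
    have hR₁1 : 1 ≤ R₁ := (hR₁ R₁ le_rfl).2
    have h1δ : 1 ≤ 1 + δ := by linarith
    -- one-sided bound, used twice
    have key : ∀ m n : ℝ, (1 + δ) * R₁ ≤ m → (1 + δ) * R₁ ≤ n → D m - D n ≤ ε / 2 := by
      intro m n hm hn
      have hm1 : R₁ ≤ m := le_trans (by nlinarith) hm
      have hm0 : 0 < m := by linarith
      have hn0 : 0 < n := by nlinarith
      have hn1 : R₁ ≤ n / (1 + δ) := by rw [le_div_iff₀ (by linarith)]; linarith
      -- upper bound at `m`
      have hup : D m ≤ L + ε / 8 := by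
        have h := (abs_lt.1 (hR₁ m hm1).1).2
        have h' := sharpDensity_le_massF_div_cube g (S := S) hgIn hm0
        simp only [hD]
        linarith
      -- lower bound at `n`
      have hlow : L - ε / 8 ≤ P * D n := by
        have h := (abs_lt.1 (hR₁ (n / (1 + δ)) hn1).1).1
        have h' := massF_div_cube_le_sharpDensity g (S := S) hn0
        rw [hgOut] at h'
        simp only [hD, hP]
        linarith
      -- combine: `P·(D m − D n) ≤ L(P−1) + (ε/8)(P+1) ≤ 56 C₀ δ + … `
      have hDn0 : 0 ≤ D n := div_nonneg ENNReal.toReal_nonneg (pow_pos hn0 3).le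
      have hc1 : P * (D m - D n) ≤ L * (P - 1) + ε / 8 * (P + 1) := by nlinarith
      have hc2 : L * (P - 1) ≤ 56 * C₀ * δ := by
        calc L * (P - 1) ≤ (C₀ * P) * (7 * δ) := mul_le_mul hLle hPδ (by linarith) (by positivity)
          _ ≤ (C₀ * 8) * (7 * δ) := by gcongr
          _ = 56 * C₀ * δ := by ring
      -- `P (D m − D n) ≤ ε/4 + (ε/8)(P+1) ≤ P ε/2` since `P ≥ 1`
      have hc3 : P * (D m - D n) ≤ P * (ε / 2) := by nlinarith
      exact le_of_mul_le_mul_left hc3 (by linarith)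
    rw [Real.dist_eq, abs_lt]
    constructor
    · linarith [key n m hn hm]
    · linarith [key m n hm hn]
  -- ### the limit
  obtain ⟨d, hd⟩ := cauchySeq_tendsto_of_complete hCauchy
  refine ⟨d, ge_of_tendsto hd ?_, hd⟩
  filter_upwards [eventually_gt_atTop (0 : ℝ)] with R hR
  exact div_nonneg ENNReal.toReal_nonneg (pow_pos hR 3).le

omit f in
/-- **Density limit `0` ⇒ `S` is null** (the support-density law `measure_eq_zero_of_supportLaw_of_density`, the hypothesis converted from
`vol(S ∩ B_R)/R³ → 0` to `vol(S ∩ B_R)/vol(B_R) → 0`). -/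
theorem measure_eq_zero_of_tendsto_sharpDensity_zero (hγ : 0 < γ) (hρ : 0 < ρ) (hV : LocallyIntegrable V volume)
    (hV2 : ∀ r : ℝ, MemLp V 2 (volume.restrict (ball (0 : EuclideanSpace ℝ (Fin 3)) r)))
    (hCA : 0 ≤ CA) (hA : ∀ L : ℝ, 2 ≤ L → ∫ y in ball (0 : EuclideanSpace ℝ (Fin 3)) L, ‖V y‖ ^ 2 ≤ CA * L ^ (1 - 2 * ρ))
    (hlaw : ∀ ψ : EuclideanSpace ℝ (Fin 3) → ℝ, IsTestFunctionOn (⊤ : Opens (EuclideanSpace ℝ (Fin 3))) ψ →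
      ∫ y in S, (3 * γ * ψ y + fderiv ℝ ψ y (selfSimilarTransport γ 0 V y)) = 0)
    (hd : Tendsto (fun R : ℝ => (volume (S ∩ ball (0 : EuclideanSpace ℝ (Fin 3)) R)).toReal / R ^ 3) atTop (𝓝 0)) :
    volume S = 0 := by
  refine measure_eq_zero_of_supportLaw_of_density hγ hρ hV hV2 hCA hA hlaw ?_
  set C₀ : ℝ := Real.pi * 4 / 3 with hC₀
  have hC₀0 : 0 < C₀ := by positivity
  have h1 : Tendsto (fun R : ℝ =>
      ENNReal.ofReal ((volume (S ∩ ball (0 : EuclideanSpace ℝ (Fin 3)) R)).toReal / R ^ 3 / C₀)) atTop (𝓝 0) := by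
    have h := hd.div_const C₀
    rw [zero_div] at h
    have h' := ENNReal.tendsto_ofReal h
    rwa [ENNReal.ofReal_zero] at h'
  refine h1.congr' ?_
  filter_upwards [eventually_gt_atTop (0 : ℝ)] with R hR
  have hfin : volume (S ∩ ball (0 : EuclideanSpace ℝ (Fin 3)) R) ≠ ⊤ :=
    (lt_of_le_of_lt (measure_mono inter_subset_right) measure_ball_lt_top).ne
  have hB : volume (ball (0 : EuclideanSpace ℝ (Fin 3)) R) = ENNReal.ofReal (R ^ 3 * C₀) := by
    rw [← volume_ball_toReal hR.le, ENNReal.ofReal_toReal measure_ball_lt_top.ne]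
  rw [div_div, ENNReal.ofReal_div_of_pos (by positivity), ENNReal.ofReal_toReal hfin, hB]

end Summit.NavierStokesRegularity.NavierStokesRegularity.Theorems.PowerGaugeEulerLiouville.WeakEulerian
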